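import Summits.NavierStokesRegularity.FunctionalMining.NoGo.PalinstrophySupRate
import Summits.NavierStokesRegularity.FunctionalMining.ThreeWaveWitness
import HarnessLib

/-!
# Log door (a), K1-Q3: the explicit 12-mode field `W12` and its exact numbers

Search for candidate a priori estimates; no regularity claim.

Cell `pub-nsfunc`, NO-GO branch, gen 4 (no-go seat `pub-nsfunc-nogo-g4`); file 2 of 3 of the kernel-checked
instance of NO-GO #4. The field: `w = realTrigPoly S c` on `T³ = (ℝ/ℤ)³`,
`S = {±(1,1,0), ±(1,−1,0), ±(1,20,0), ±(1,−20,0), ±(0,19,0), ±(0,21,0)}`, planar coefficients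
`ĉ(σ₁,σ₂,0) = (−iσ₁b, iσ₂b, 0)` (a Taylor–Green cell, vorticity `ω₃ = sin 2πx sin 2πy`), packet coefficients
`ĉ = (0,0,a)` (vertical velocity `4a(cos 2πx + cos 2πy) cos 40πy`, riding on the cell's straining zero-lines),
`b = 1/(16π)`, `a = 1/(900π)`. Proved by finite Parseval in the vocabulary of `ThreeWaveWitness.lean`:
smooth, divergence-free, `Δw`, `Δ²w`, the twelve convection coefficients, and the exact values
`N(w) = (8576/675)π²`, `𝒫(w) = (464686/16875)π²`, `D₃(w) = (2095005232/50625)π⁴`. The coefficient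
function is written through decidable coordinate predicates (`IsPlanar`, `IsPacket`) so that `simp`
evaluates it at every literal / difference vector. Cross-check in exact rational arithmetic:
`pub-nsfunc-nogo/cert/cert_min.py --K 20 --alpha2 1/50625 --At 50000 --C 1/40 --c 1`.
-/

noncomputable section

open MeasureTheory Complex
open scoped RealInnerProductSpace

namespace Summit.NavierStokesRegularity.FunctionalMining

open Literature.Analysis Literature.Analysis.FunctionSpaces Literature.Analysis.FunctionSpaces.Torus
  Literature.Analysis.FluidPDE

namespace LogDoorW12

/-! ## Support and coefficients -/

/-- `(1,1,0)`. [folklore] -/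
def p1 : Fin 3 → ℤ := ![1, 1, 0]
/-- `(1,-1,0)`. [folklore] -/
def p2 : Fin 3 → ℤ := ![1, -1, 0]
/-- `(1,20,0)`. [folklore] -/
def q1 : Fin 3 → ℤ := ![1, 20, 0]
/-- `(1,-20,0)`. [folklore] -/
def q2 : Fin 3 → ℤ := ![1, -20, 0]
/-- `(0,19,0)`. [folklore] -/
def q3 : Fin 3 → ℤ := ![0, 19, 0]
/-- `(0,21,0)`. [folklore] -/
def q4 : Fin 3 → ℤ := ![0, 21, 0]

/-- The Fourier support (12 wavevectors). [folklore] -/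
def S : Finset (Fin 3 → ℤ) := {p1, -p1, p2, -p2, q1, -q1, q2, -q2, q3, -q3, q4, -q4}

/-- Planar amplitude `b = 1/(16π)`. [folklore] -/
def b : ℝ := 1 / (16 * Real.pi)
/-- Packet amplitude `a = 1/(900π)`. [folklore] -/
def a : ℝ := 1 / (900 * Real.pi)

/-- `0 < b`. [folklore] -/ theorem b_pos : 0 < b := by unfold b; positivity
/-- `0 < a`. [folklore] -/ theorem a_pos : 0 < a := by unfold a; positivity

/-- Planar modes `(±1,±1,0)`. [folklore] -/
def IsPlanar (k : Fin 3 → ℤ) : Prop := k 2 = 0 ∧ (k 0 = 1 ∨ k 0 = -1) ∧ (k 1 = 1 ∨ k 1 = -1)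
/-- Packet modes `(±1,±20,0), (0,±19,0), (0,±21,0)`. [folklore] -/
def IsPacket (k : Fin 3 → ℤ) : Prop :=
  k 2 = 0 ∧ (((k 0 = 1 ∨ k 0 = -1) ∧ (k 1 = 20 ∨ k 1 = -20)) ∨
    (k 0 = 0 ∧ (k 1 = 19 ∨ k 1 = -19 ∨ k 1 = 21 ∨ k 1 = -21)))

/-- `IsPlanar` is decidable. [folklore] -/ instance (k : Fin 3 → ℤ) : Decidable (IsPlanar k) := by unfold IsPlanar; infer_instance
/-- `IsPacket` is decidable. [folklore] -/ instance (k : Fin 3 → ℤ) : Decidable (IsPacket k) := by unfold IsPacket; infer_instance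

/-- The coefficients: `ĉ(σ₁,σ₂,0) = (−iσ₁b, iσ₂b, 0)` on planar modes, `(0,0,a)` on packet modes,
`0` elsewhere. [folklore] -/
def c (k : Fin 3 → ℤ) : EuclideanSpace ℂ (Fin 3) :=
  if IsPlanar k then !₂[-(I * (b : ℂ) * (k 0 : ℂ)), I * (b : ℂ) * (k 1 : ℂ), 0]
  else if IsPacket k then !₂[0, 0, (a : ℂ)] else 0

/-- The field `W12`. [folklore] -/
def w : UnitAddTorus (Fin 3) → EuclideanSpace ℝ (Fin 3) := realTrigPoly S c

/-! ## Bookkeeping on the support -/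

/-- `S` is symmetric under `k ↦ −k`. [folklore] -/
theorem neg_mem_S : ∀ k ∈ S, -k ∈ S := by
  intro k hk
  simp only [S, Finset.mem_insert, Finset.mem_singleton] at hk ⊢
  rcases hk with rfl | rfl | rfl | rfl | rfl | rfl | rfl | rfl | rfl | rfl | rfl | rfl <;> simp

/-- Sums over `S`, unrolled. [folklore] -/
theorem sum_S {M : Type*} [AddCommMonoid M] (f : (Fin 3 → ℤ) → M) :
    ∑ k ∈ S, f k = f p1 + f (-p1) + f p2 + f (-p2) + f q1 + f (-q1) + f q2 + f (-q2) +
      f q3 + f (-q3) + f q4 + f (-q4) := by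
  simp only [S]
  rw [Finset.sum_insert, Finset.sum_insert, Finset.sum_insert, Finset.sum_insert,
    Finset.sum_insert, Finset.sum_insert, Finset.sum_insert, Finset.sum_insert,
    Finset.sum_insert, Finset.sum_insert, Finset.sum_insert, Finset.sum_singleton]
  · simp only [add_assoc]
  all_goals
    simp only [Finset.mem_insert, Finset.mem_singleton, not_or, p1, p2, q1, q2, q3, q4]
    decide

/-- `IsPlanar` is even in `k`. [folklore] -/ theorem isPlanar_neg (k : Fin 3 → ℤ) : IsPlanar (-k) ↔ IsPlanar k := by
  unfold IsPlanar; simp only [Pi.neg_apply]; omega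

/-- `IsPacket` is even in `k`. [folklore] -/ theorem isPacket_neg (k : Fin 3 → ℤ) : IsPacket (-k) ↔ IsPacket k := by
  unfold IsPacket; simp only [Pi.neg_apply]; omega

/-- Packet modes are not planar. [folklore] -/ theorem not_isPlanar_of_isPacket {k : Fin 3 → ℤ} (h : IsPacket k) : ¬ IsPlanar k := by
  unfold IsPlanar; unfold IsPacket at h; omega

/-- Off the support the coefficients vanish. [folklore] -/
theorem c_eq_zero {k : Fin 3 → ℤ} (hk : k ∉ S) : c k = 0 := by
  have hk3 : k = ![k 0, k 1, k 2] := by ext i; fin_cases i <;> rfl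
  unfold c
  split_ifs with h1 h2
  · exfalso; apply hk
    obtain ⟨h2, h0 | h0, h1 | h1⟩ := h1 <;> rw [hk3, h0, h1, h2] <;>
      simp [S, p1, p2, q1, q2, q3, q4]
  · exfalso; apply hk
    obtain ⟨hz, ⟨h0 | h0, h1 | h1⟩ | ⟨h0, h1 | h1 | h1 | h1⟩⟩ := h2 <;> rw [hk3, h0, h1, hz] <;>
      simp [S, p1, p2, q1, q2, q3, q4]
  · rfl

/-- **Reality**: `ĉ(−k) = conj ĉ(k)`. [folklore] -/
theorem isConjSymm_c : IsConjSymm c := by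
  intro k
  by_cases hP : IsPlanar k
  · have hP' : IsPlanar (-k) := (isPlanar_neg k).mpr hP
    rw [c, c, if_pos hP', if_pos hP]
    ext i; fin_cases i <;> simp [EuclideanSpace.conjVec_apply, conj_ofReal, mul_comm]
  · have hP' : ¬ IsPlanar (-k) := fun h => hP ((isPlanar_neg k).mp h)
    by_cases hQ : IsPacket k
    · have hQ' : IsPacket (-k) := (isPacket_neg k).mpr hQ
      rw [c, c, if_neg hP', if_pos hQ', if_neg hP, if_pos hQ]
      ext i; fin_cases i <;> simp [EuclideanSpace.conjVec_apply, conj_ofReal]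
    · have hQ' : ¬ IsPacket (-k) := fun h => hQ ((isPacket_neg k).mp h)
      rw [c, c, if_neg hP', if_neg hQ', if_neg hP, if_neg hQ, EuclideanSpace.conjVec_zero]

/-- **Incompressibility**: `k · ĉ(k) = 0`. [folklore] -/
theorem isTransversal_c : IsTransversal S c := by
  intro k _
  by_cases hP : IsPlanar k
  · rw [c, if_pos hP]
    obtain ⟨h2, h0, h1⟩ := hP
    rcases h0 with h0 | h0 <;> rcases h1 with h1 | h1 <;>
      simp [Fin.sum_univ_three, h0, h1, h2]
  · by_cases hQ : IsPacket k
    · rw [c, if_neg hP, if_pos hQ]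
      simp [Fin.sum_univ_three, hQ.1]
    · rw [c, if_neg hP, if_neg hQ]
      simp

/-! ## The field: smooth and divergence free -/

/-- `w` is smooth. [folklore] -/ theorem isSmooth_w : IsSmooth w := isSmooth_realTrigPoly S c

/-- `w` is divergence free. [folklore] -/ theorem isDivFree_w : IsDivFree w := isDivFree_realTrigPoly isTransversal_c

/-! ## Laplacian and bi-Laplacian coefficients -/

/-- `−4π²|k|² ĉ(k)`. [folklore] -/
def cΔ (k : Fin 3 → ℤ) : EuclideanSpace ℂ (Fin 3) :=
  -(((4 * Real.pi ^ 2 * freqNormSq k : ℝ) : ℂ) • c k)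

/-- `16π⁴|k|⁴ ĉ(k)`, written as `−4π²|k|² • cΔ k`. [folklore] -/
def cΔΔ (k : Fin 3 → ℤ) : EuclideanSpace ℂ (Fin 3) :=
  -(((4 * Real.pi ^ 2 * freqNormSq k : ℝ) : ℂ) • cΔ k)

/-- `Δw = realTrigPoly S cΔ`. [folklore] -/ theorem laplacian_w : Torus.laplacian w = realTrigPoly S cΔ := funext (laplacian_realTrigPoly S c)

/-- `Δ²w = realTrigPoly S cΔΔ`. [folklore] -/ theorem laplacian2_w (x : UnitAddTorus (Fin 3)) :
    Torus.laplacian (Torus.laplacian w) x = realTrigPoly S cΔΔ x := by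
  rw [laplacian_w]; exact laplacian_realTrigPoly S cΔ x

/-- Reality of `cΔ`. [folklore] -/ theorem isConjSymm_cΔ : IsConjSymm cΔ := by
  intro k
  simp only [cΔ]
  rw [isConjSymm_c k, freqNormSq_neg, EuclideanSpace.conjVec_neg, EuclideanSpace.conjVec_smul,
    Complex.conj_ofReal]

/-- Reality of `cΔΔ`. [folklore] -/ theorem isConjSymm_cΔΔ : IsConjSymm cΔΔ := by
  intro k
  simp only [cΔΔ]
  rw [isConjSymm_cΔ k, freqNormSq_neg, EuclideanSpace.conjVec_neg, EuclideanSpace.conjVec_smul,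
    Complex.conj_ofReal]

/-! ## The production as a finite sum -/

/-- `N(w) = −∑_{k∈S} Re⟪N̂(k), 16π⁴|k|⁴ ĉ(k)⟫_ℂ`, `N̂ = convectionCoeff S ĉ ĉ`. [folklore] -/
theorem production_eq_sum :
    palinstrophyProduction w = -∑ k ∈ S, (inner ℂ (Torus.convectionCoeff S c c k) (cΔΔ k)).re := by
  unfold palinstrophyProduction
  simp_rw [laplacian2_w]
  rw [integral_inner_realTrigPoly_right neg_mem_S isConjSymm_cΔΔ
    ((isSmooth_w.convect isSmooth_w).memLp 2)]
  congr 1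
  refine Finset.sum_congr rfl fun k _ => ?_
  rw [show w = realTrigPoly S c from rfl,
    Torus.mFourierCoeff_convect_realTrigPoly neg_mem_S isConjSymm_c isConjSymm_c k]

/-- The convection symbol as a single sum (the coefficients vanish off `S`):
`N̂(k) = ∑_{l∈S} (2πi ĉ(l)·(k−l)) ĉ(k−l)`. [folklore] -/
theorem convectionCoeff_eq (k : Fin 3 → ℤ) :
    Torus.convectionCoeff S c c k =
      ∑ l ∈ S, (2 * Real.pi * I * ∑ j, c l j * ((k - l) j : ℂ)) • c (k - l) := by
  rw [Torus.convectionCoeff]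
  refine Finset.sum_congr rfl fun l _ => ?_
  by_cases hm : k - l ∈ S
  · rw [Finset.sum_eq_single (k - l)]
    · rw [if_pos (add_sub_cancel l k)]
    · intro m _ hne
      rw [if_neg]
      intro h
      exact hne (eq_sub_of_add_eq' h)
    · intro h; exact absurd hm h
  · rw [c_eq_zero hm, smul_zero]
    refine Finset.sum_eq_zero fun m hmS => ?_
    rw [if_neg]
    intro h
    exact hm ((eq_sub_of_add_eq' h) ▸ hmS)

/-! ## Coefficient and frequency tables -/

/-- `ĉ(p₁)`. [folklore] -/ theorem c_p1 : c p1 = !₂[-(I * (b : ℂ)), I * (b : ℂ), 0] := by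
  ext i; fin_cases i <;> simp [c, IsPlanar, p1]
/-- `ĉ(−p₁)`. [folklore] -/ theorem c_np1 : c (-p1) = !₂[I * (b : ℂ), -(I * (b : ℂ)), 0] := by
  ext i; fin_cases i <;> simp [c, IsPlanar, p1]
/-- `ĉ(p₂)`. [folklore] -/ theorem c_p2 : c p2 = !₂[-(I * (b : ℂ)), -(I * (b : ℂ)), 0] := by
  ext i; fin_cases i <;> simp [c, IsPlanar, p2]
/-- `ĉ(−p₂)`. [folklore] -/ theorem c_np2 : c (-p2) = !₂[I * (b : ℂ), I * (b : ℂ), 0] := by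
  ext i; fin_cases i <;> simp [c, IsPlanar, p2]
/-- `ĉ(q₁)`. [folklore] -/ theorem c_q1 : c q1 = !₂[0, 0, (a : ℂ)] := by
  ext i; fin_cases i <;> simp [c, IsPlanar, IsPacket, q1]
/-- `ĉ(−q₁)`. [folklore] -/ theorem c_nq1 : c (-q1) = !₂[0, 0, (a : ℂ)] := by
  ext i; fin_cases i <;> simp [c, IsPlanar, IsPacket, q1]
/-- `ĉ(q₂)`. [folklore] -/ theorem c_q2 : c q2 = !₂[0, 0, (a : ℂ)] := by
  ext i; fin_cases i <;> simp [c, IsPlanar, IsPacket, q2]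
/-- `ĉ(−q₂)`. [folklore] -/ theorem c_nq2 : c (-q2) = !₂[0, 0, (a : ℂ)] := by
  ext i; fin_cases i <;> simp [c, IsPlanar, IsPacket, q2]
/-- `ĉ(q₃)`. [folklore] -/ theorem c_q3 : c q3 = !₂[0, 0, (a : ℂ)] := by
  ext i; fin_cases i <;> simp [c, IsPlanar, IsPacket, q3]
/-- `ĉ(−q₃)`. [folklore] -/ theorem c_nq3 : c (-q3) = !₂[0, 0, (a : ℂ)] := by
  ext i; fin_cases i <;> simp [c, IsPlanar, IsPacket, q3]
/-- `ĉ(q₄)`. [folklore] -/ theorem c_q4 : c q4 = !₂[0, 0, (a : ℂ)] := by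
  ext i; fin_cases i <;> simp [c, IsPlanar, IsPacket, q4]
/-- `ĉ(−q₄)`. [folklore] -/ theorem c_nq4 : c (-q4) = !₂[0, 0, (a : ℂ)] := by
  ext i; fin_cases i <;> simp [c, IsPlanar, IsPacket, q4]

/-- `|k|²` on the support: `2` (planar), `401`, `361`, `441` (packet). [folklore] -/
theorem freqNormSq_table :
    freqNormSq p1 = 2 ∧ freqNormSq (-p1) = 2 ∧ freqNormSq p2 = 2 ∧ freqNormSq (-p2) = 2 ∧
    freqNormSq q1 = 401 ∧ freqNormSq (-q1) = 401 ∧ freqNormSq q2 = 401 ∧ freqNormSq (-q2) = 401 ∧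
    freqNormSq q3 = 361 ∧ freqNormSq (-q3) = 361 ∧ freqNormSq q4 = 441 ∧ freqNormSq (-q4) = 441 := by
  refine ⟨?_, ?_, ?_, ?_, ?_, ?_, ?_, ?_, ?_, ?_, ?_, ?_⟩ <;>
    simp [freqNormSq, p1, p2, q1, q2, q3, q4, Fin.sum_univ_three] <;> norm_num

/-- `‖ĉ(k)‖²` on the support: `2b²` (planar), `a²` (packet). [folklore] -/
theorem norm_sq_c_table :
    ‖c p1‖ ^ 2 = 2 * b ^ 2 ∧ ‖c (-p1)‖ ^ 2 = 2 * b ^ 2 ∧ ‖c p2‖ ^ 2 = 2 * b ^ 2 ∧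
    ‖c (-p2)‖ ^ 2 = 2 * b ^ 2 ∧ ‖c q1‖ ^ 2 = a ^ 2 ∧ ‖c (-q1)‖ ^ 2 = a ^ 2 ∧
    ‖c q2‖ ^ 2 = a ^ 2 ∧ ‖c (-q2)‖ ^ 2 = a ^ 2 ∧ ‖c q3‖ ^ 2 = a ^ 2 ∧ ‖c (-q3)‖ ^ 2 = a ^ 2 ∧
    ‖c q4‖ ^ 2 = a ^ 2 ∧ ‖c (-q4)‖ ^ 2 = a ^ 2 := by
  refine ⟨?_, ?_, ?_, ?_, ?_, ?_, ?_, ?_, ?_, ?_, ?_, ?_⟩ <;>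
    simp [c_p1, c_np1, c_p2, c_np2, c_q1, c_nq1, c_q2, c_nq2, c_q3, c_nq3, c_q4, c_nq4,
      EuclideanSpace.norm_sq_eq, Fin.sum_univ_three] <;> ring

/-! ## The twelve convection coefficients -/

/-- `N̂(±p₁) = N̂(±p₂) = 0`: no resonant pair lands on a planar mode. [folklore] -/
theorem convectionCoeff_p1 : Torus.convectionCoeff S c c p1 = 0 := by
  rw [convectionCoeff_eq, sum_S]
  ext i; fin_cases i <;> simp [c, IsPlanar, IsPacket, p1, p2, q1, q2, q3, q4, Fin.sum_univ_three]
/-- `N̂(−p₁) = 0`. [folklore] -/ theorem convectionCoeff_np1 : Torus.convectionCoeff S c c (-p1) = 0 := by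
  rw [convectionCoeff_eq, sum_S]
  ext i; fin_cases i <;> simp [c, IsPlanar, IsPacket, p1, p2, q1, q2, q3, q4, Fin.sum_univ_three]
/-- `N̂(p₂) = 0`. [folklore] -/ theorem convectionCoeff_p2 : Torus.convectionCoeff S c c p2 = 0 := by
  rw [convectionCoeff_eq, sum_S]
  ext i; fin_cases i <;> simp [c, IsPlanar, IsPacket, p1, p2, q1, q2, q3, q4, Fin.sum_univ_three]
/-- `N̂(−p₂) = 0`. [folklore] -/ theorem convectionCoeff_np2 : Torus.convectionCoeff S c c (-p2) = 0 := by
  rw [convectionCoeff_eq, sum_S]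
  ext i; fin_cases i <;> simp [c, IsPlanar, IsPacket, p1, p2, q1, q2, q3, q4, Fin.sum_univ_three]

/-- `N̂(±q₁) = N̂(±q₂) = (0,0,4πab)` (two resonant pairs each, `∑(σ₂m₁−σ₁m₀) = −2`). [folklore] -/
theorem convectionCoeff_q1 :
    Torus.convectionCoeff S c c q1 = !₂[0, 0, 4 * (Real.pi : ℂ) * (a : ℂ) * (b : ℂ)] := by
  rw [convectionCoeff_eq, sum_S]
  ext i; fin_cases i <;> simp [c, IsPlanar, IsPacket, p1, p2, q1, q2, q3, q4, Fin.sum_univ_three]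
  ring_nf; simp [Complex.I_sq]
/-- `N̂(−q₁) = (0,0,4πab)`. [folklore] -/ theorem convectionCoeff_nq1 :
    Torus.convectionCoeff S c c (-q1) = !₂[0, 0, 4 * (Real.pi : ℂ) * (a : ℂ) * (b : ℂ)] := by
  rw [convectionCoeff_eq, sum_S]
  ext i; fin_cases i <;> simp [c, IsPlanar, IsPacket, p1, p2, q1, q2, q3, q4, Fin.sum_univ_three]
  ring_nf; simp [Complex.I_sq]
/-- `N̂(q₂) = (0,0,4πab)`. [folklore] -/ theorem convectionCoeff_q2 :
    Torus.convectionCoeff S c c q2 = !₂[0, 0, 4 * (Real.pi : ℂ) * (a : ℂ) * (b : ℂ)] := by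
  rw [convectionCoeff_eq, sum_S]
  ext i; fin_cases i <;> simp [c, IsPlanar, IsPacket, p1, p2, q1, q2, q3, q4, Fin.sum_univ_three]
  ring_nf; simp [Complex.I_sq]
/-- `N̂(−q₂) = (0,0,4πab)`. [folklore] -/ theorem convectionCoeff_nq2 :
    Torus.convectionCoeff S c c (-q2) = !₂[0, 0, 4 * (Real.pi : ℂ) * (a : ℂ) * (b : ℂ)] := by
  rw [convectionCoeff_eq, sum_S]
  ext i; fin_cases i <;> simp [c, IsPlanar, IsPacket, p1, p2, q1, q2, q3, q4, Fin.sum_univ_three]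
  ring_nf; simp [Complex.I_sq]

/-- `N̂(±q₃) = (0,0,76πab)` (`q₃ = (0,19,0)`, `∑(σ₂m₁−σ₁m₀) = −38`). [folklore] -/
theorem convectionCoeff_q3 :
    Torus.convectionCoeff S c c q3 = !₂[0, 0, 76 * (Real.pi : ℂ) * (a : ℂ) * (b : ℂ)] := by
  rw [convectionCoeff_eq, sum_S]
  ext i; fin_cases i <;> simp [c, IsPlanar, IsPacket, p1, p2, q1, q2, q3, q4, Fin.sum_univ_three]
  ring_nf; simp [Complex.I_sq]
/-- `N̂(−q₃) = (0,0,76πab)`. [folklore] -/ theorem convectionCoeff_nq3 :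
    Torus.convectionCoeff S c c (-q3) = !₂[0, 0, 76 * (Real.pi : ℂ) * (a : ℂ) * (b : ℂ)] := by
  rw [convectionCoeff_eq, sum_S]
  ext i; fin_cases i <;> simp [c, IsPlanar, IsPacket, p1, p2, q1, q2, q3, q4, Fin.sum_univ_three]
  ring_nf; simp [Complex.I_sq]

/-- `N̂(±q₄) = (0,0,−84πab)` (`q₄ = (0,21,0)`, `∑(σ₂m₁−σ₁m₀) = 42`). [folklore] -/
theorem convectionCoeff_q4 :
    Torus.convectionCoeff S c c q4 = !₂[0, 0, -(84 * (Real.pi : ℂ) * (a : ℂ) * (b : ℂ))] := by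
  rw [convectionCoeff_eq, sum_S]
  ext i; fin_cases i <;> simp [c, IsPlanar, IsPacket, p1, p2, q1, q2, q3, q4, Fin.sum_univ_three]
  ring_nf; simp [Complex.I_sq]
/-- `N̂(−q₄) = (0,0,−84πab)`. [folklore] -/ theorem convectionCoeff_nq4 :
    Torus.convectionCoeff S c c (-q4) = !₂[0, 0, -(84 * (Real.pi : ℂ) * (a : ℂ) * (b : ℂ))] := by
  rw [convectionCoeff_eq, sum_S]
  ext i; fin_cases i <;> simp [c, IsPlanar, IsPacket, p1, p2, q1, q2, q3, q4, Fin.sum_univ_three]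
  ring_nf; simp [Complex.I_sq]

/-! ## The three global numbers -/

/-- **Production** `N(w) = 164659200 π⁵ a² b`. [folklore] -/
theorem production_w : palinstrophyProduction w = 164659200 * Real.pi ^ 5 * a ^ 2 * b := by
  obtain ⟨h1, h2, h3, h4, h5, h6, h7, h8, h9, h10, h11, h12⟩ := freqNormSq_table
  rw [production_eq_sum, sum_S, convectionCoeff_p1, convectionCoeff_np1, convectionCoeff_p2,
    convectionCoeff_np2, convectionCoeff_q1, convectionCoeff_nq1, convectionCoeff_q2,
    convectionCoeff_nq2, convectionCoeff_q3, convectionCoeff_nq3, convectionCoeff_q4,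
    convectionCoeff_nq4]
  simp only [cΔΔ, cΔ, c_p1, c_np1, c_p2, c_np2, c_q1, c_nq1, c_q2, c_nq2, c_q3, c_nq3, c_q4,
    c_nq4, h1, h2, h3, h4, h5, h6, h7, h8, h9, h10, h11, h12]
  simp [PiLp.inner_apply, Fin.sum_univ_three, Complex.mul_re, Complex.mul_im, -Complex.ofReal_pow]
  ring

/-- `N(w) = (8576/675) π²` (`= 643200 π² α²` with `α² = 16π²a² = 1/50625`). [folklore] -/
theorem production_w_eq : palinstrophyProduction w = 8576 / 675 * Real.pi ^ 2 := by
  rw [production_w, a, b]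
  field_simp
  ring

/-- **Palinstrophy** `𝒫(w) = ∫‖Δw‖² = 16π⁴ (32 b² + 1292808 a²)`. [folklore] -/
theorem palinstrophy_w :
    torusPalinstrophy w = 16 * Real.pi ^ 4 * (32 * b ^ 2 + 1292808 * a ^ 2) := by
  obtain ⟨h1, h2, h3, h4, h5, h6, h7, h8, h9, h10, h11, h12⟩ := freqNormSq_table
  obtain ⟨n1, n2, n3, n4, n5, n6, n7, n8, n9, n10, n11, n12⟩ := norm_sq_c_table
  unfold torusPalinstrophy
  simp only [laplacian_w]
  rw [integral_norm_sq_realTrigPoly neg_mem_S isConjSymm_cΔ, sum_S]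
  simp only [cΔ, norm_neg, norm_smul, mul_pow, Complex.norm_real, Real.norm_eq_abs, sq_abs,
    h1, h2, h3, h4, h5, h6, h7, h8, h9, h10, h11, h12,
    n1, n2, n3, n4, n5, n6, n7, n8, n9, n10, n11, n12]
  ring

/-- `𝒫(w) = (464686/16875) π²`. [folklore] -/
theorem palinstrophy_w_eq : torusPalinstrophy w = 464686 / 16875 * Real.pi ^ 2 := by
  rw [palinstrophy_w, a, b]
  field_simp
  ring

/-- **Dissipation** `D₃(w) = ‖∇Δw‖₂² = 64π⁶ (64 b² + 523548808 a²)`. [folklore] -/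
theorem dissipation_w :
    palinstrophyDissipation w = 64 * Real.pi ^ 6 * (64 * b ^ 2 + 523548808 * a ^ 2) := by
  obtain ⟨h1, h2, h3, h4, h5, h6, h7, h8, h9, h10, h11, h12⟩ := freqNormSq_table
  obtain ⟨n1, n2, n3, n4, n5, n6, n7, n8, n9, n10, n11, n12⟩ := norm_sq_c_table
  unfold palinstrophyDissipation
  rw [laplacian_w, gradNormSq_eq_toReal_eGradNormSq_holds (isSmooth_realTrigPoly S cΔ),
    toReal_eGradNormSq_realTrigPoly neg_mem_S isConjSymm_cΔ, sum_S]
  simp only [cΔ, norm_neg, norm_smul, mul_pow, Complex.norm_real, Real.norm_eq_abs, sq_abs,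
    h1, h2, h3, h4, h5, h6, h7, h8, h9, h10, h11, h12,
    n1, n2, n3, n4, n5, n6, n7, n8, n9, n10, n11, n12]
  ring

/-- `D₃(w) = (2095005232/50625) π⁴`. [folklore] -/
theorem dissipation_w_eq : palinstrophyDissipation w = 2095005232 / 50625 * Real.pi ^ 4 := by
  rw [dissipation_w, a, b]
  field_simp
  ring

end LogDoorW12

end Summit.NavierStokesRegularity.FunctionalMining

end
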